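import Literature.AlgebraicGeometry.AbelianSchemes.FiniteFlatSubgroupKilledByInvertibleRank
import Literature.AlgebraicGeometry.AbelianSchemes.PolarizationTwoLamClassifiesLDelta
import Literature.AlgebraicGeometry.AbelianSchemes.LDeltaRigidifiedFibrewiseAmple
import Literature.AlgebraicGeometry.AbelianSchemes.AbelianLiftOfClosedFibreLetter
import Literature.AlgebraicGeometry.Modules.FinrankOfPushforwardUnitHasRank
import HarnessLib

/-!
# (U) for POLARISED abelian schemes: `X₀ → Spec (A⧸J₀)` with a finite flat polarisation of constant rank `N`, `2N ∈ A^×`, lifts to `Spec A`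
# — sketch (O9e), the (O9) chain closed

Layer `Literature/AlgebraicGeometry/AbelianSchemes` (namespace `Literature.AlgebraicGeometry.AbelianSchemes.AbelianSchemeOver`).  THEOREMS ONLY
(no definition, no named fact, no instance, no notation, no `sorry`).  Cell `hodgecm-mathlib` (D-0151), sub-desk P6b: the per-instance,
characteristic-free discharge of the banked §1 stub `stub_L4B1u_abelianLiftOfIsUnitTwo` of `Cruxes/HLiu418/Lines/F0_P6b_BTSerreTate.lean`
(ED. 4) in the ROW-4 REGIME «principally ∕ prime-to-`p` polarised» ([MumfordFogartyKirwan1994] Ch. 7 §2 Def. 7.2 (ii): `λ_* 𝒪_X` locally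
free of rank `d²`; here in Mathlib's `Scheme.Hom.finrank` currency, census `CENSUS-O9-polarisedKill.v1` + add1 A3):
`A` Artinian local, `2 ∈ A^×`, `J₀ ≠ ⊤`, `X₀ → Spec (A⧸J₀)` projective abelian of relative dimension `g` with a dual pair `(Â₀, 𝒫)` whose
unit hypothesis `hD` holds (automatic over a reduced base, ★ `Polarization.nonempty_unitHatSlice_iso`) and a polarisation `λ : X₀ → Â₀`
finite, flat, of constant rank `N` with `N ∈ (A⧸J₀)^×` ⇒ `X₀` lifts to an abelian scheme over `Spec A`.
Proof = ★ (O8d) `exists_abelianLift_of_isUnit_two_of_letter` with `L := L^Δ(λ) = Gr_λ^* 𝒫` (`Gr_λ` the graph of `λ`, Mathlib `pullback.lift`):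
rank one ★ `hasRank_pullback_graph_P`, rigidified ★ `Polarization.cechPic_pullback_unitSection_detClass_LDelta_eq_one`, fibrewise ample ★
`Polarization.exists_isAmple_pullback_fst_detClass_LDelta_eq_cechClass` ([MumfordFogartyKirwan1994] Prop. 6.10), and `K(L^Δ(λ))` killed by
`n := 2N`: `u ∈ K(L^Δ(λ))(T) ↔ u ≫ [2] ≫ λ = 1` (★ `Polarization.sq_comp_lam_classify_mumfordBundle_LDelta`) and `Ker λ` is killed by `N`
(★ (O9d) `Polarization.pow_eq_one_of_comp_lam_eq_one_of_finrank_lam_eq`: Deligne on the fibres + unramifiedness, [MumfordAV1970] §13,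
[GortzWedhorn2023] Prop. 27.86).  §2 restates the head in the cell's BOOKED currency ★ `Polarization.HasDegree d` ([MumfordFogartyKirwan1994] Def. 7.2
(ii) verbatim, `λ_* 𝒪` locally free of rank `d²`; `λ` finite — flatness FOLLOWS, ★ (O9f) `flat_lam_left_of_hasDegree`) with `2d ∈ A^×`, through the
dictionary ★ (O9f) `Polarization.finrank_lam_left_eq_of_hasDegree`.
HC_CM is proved only modulo the printed citations until rung 0 closes; nothing here is about HC.

## References
* [Oort1971] F. Oort, *Finite group schemes, local moduli for abelian varieties, and lifting problems*, Compositio Math. 23 (1971), Thm. (2.2.1) (p. 273).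
* [MumfordAV1970] D. Mumford, *Abelian Varieties* (1970), §13 (p. 123), §13 Cor. 2 (p. 129), §23 (p. 231).
* [MumfordFogartyKirwan1994] D. Mumford, J. Fogarty, F. Kirwan, *GIT*, 3rd ed. (1994), Ch. 6 §2 Def. 6.2 (p. 120), Prop. 6.10 (p. 121); Ch. 7 §2 Def. 7.2 (p. 129).
* [GortzWedhorn2023] U. Görtz, T. Wedhorn, *Algebraic Geometry II* (2023), Prop. 27.86 (p. 633), Cor. 27.63.
-/

set_option autoImplicit false

noncomputable section

set_option backward.isDefEq.respectTransparency false

open CategoryTheory CategoryTheory.Limits AlgebraicGeometry IsLocalRing MonoidalCategory CartesianMonoidalCategory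
open Literature.AlgebraicGeometry.Morphisms Literature.AlgebraicGeometry.Motives Literature.AlgebraicGeometry.Modules

namespace Literature.AlgebraicGeometry.AbelianSchemes.AbelianSchemeOver

variable {A : Type} [CommRing A] [IsArtinianRing A] [IsLocalRing A]

open scoped MonObj in
/-- **(O9e) = (U) for polarised abelian schemes of invertible rank.**  `A` Artinian local, `2 ∈ A^×`, `J₀ ≠ ⊤`; `X₀ → Spec (A⧸J₀)` projective
abelian of relative dimension `g`, `(Â₀, 𝒫)` a dual pair satisfying the unit hypothesis `hD`, `λ : X₀ → Â₀` a polarisation, finite and flat of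
constant rank `N` with `N ∈ (A⧸J₀)^×` ⇒ `X₀` lifts to an abelian scheme `X → Spec A` of relative dimension `g`.
[cite: Oort1971, Theorem (2.2.1) (p. 273) and pp. 277–280] [cite: MumfordFogartyKirwan1994, Ch. 6 §2 Proposition 6.10 (p. 121); Ch. 7 §2 Definition 7.2 (p. 129)]
[cite: MumfordAV1970, §13 (p. 123), §13 Cor. 2 (p. 129), §23 (p. 231)] [cite: GortzWedhorn2023, Prop. 27.86 (p. 633)] -/
theorem exists_abelianLift_of_isUnit_two_of_polarization_finrank_eq (J₀ : Ideal A) (hJ₀ : J₀ ≠ ⊤) {g : ℕ} (h2 : IsUnit (2 : A))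
    (X₀ : AbelianSchemeOver (Spec (.of (A ⧸ J₀)))) (hg : X₀.IsOfRelDim g) (hP : Morphisms.IsProjective X₀.X.hom)
    (D : X₀.DualPair) (hD : Nonempty ((Scheme.Modules.pullback (DualPair.unitHatSlice D)).obj D.P ≅ SheafOfModules.unit _))
    (pol : X₀.Polarization D) [IsFinite pol.lam.left] [Flat pol.lam.left]
    {N : ℕ} [NeZero N] (hdeg : ∀ y : D.hat.X.left, pol.lam.left.finrank y = N) (hN : IsUnit ((N : ℕ) : A ⧸ J₀)) :
    ∃ (X : AbelianSchemeOver (Spec (.of A))) (_ : X.IsOfRelDim g) (G : X₀.X.left ⟶ X.X.left),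
      X₀.IsBaseChangeVia X (Spec.map (CommRingCat.ofHom (Ideal.Quotient.mk J₀))) G := by
  haveI := pol.isMonHom
  -- `Spec (A⧸J₀)` is a one-point locally Noetherian scheme
  haveI : Nontrivial (A ⧸ J₀) := Ideal.Quotient.nontrivial_iff.mpr hJ₀
  haveI : IsLocalRing (A ⧸ J₀) := IsLocalRing.of_surjective' (Ideal.Quotient.mk J₀) Ideal.Quotient.mk_surjective
  haveI : Subsingleton (Spec (.of (A ⧸ J₀)) : Scheme) := inferInstanceAs (Subsingleton (PrimeSpectrum (A ⧸ J₀)))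
  haveI : PreconnectedSpace (Spec (.of (A ⧸ J₀)) : Scheme) := ⟨Set.subsingleton_univ.isPreconnected⟩
  haveI : Nonempty (Spec (.of (A ⧸ J₀)) : Scheme) := inferInstanceAs (Nonempty (PrimeSpectrum (A ⧸ J₀)))
  haveI : IsLocallyNoetherian (Spec (.of (A ⧸ J₀))) := inferInstance
  -- the graph of `λ` and `L^Δ(λ) = Gr^* 𝒫`
  let Gr : X₀.X.left ⟶ X₀.prodLeft D.hat := pullback.lift (𝟙 _) pol.lam.left (by rw [Category.id_comp, Over.w pol.lam])
  have hGr₁ : Gr ≫ pullback.fst X₀.X.hom D.hat.X.hom = 𝟙 _ := pullback.lift_fst _ _ _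
  have hGr₂ : Gr ≫ pullback.snd X₀.X.hom D.hat.X.hom = pol.lam.left := pullback.lift_snd _ _ _
  have hL : HasRank ((Scheme.Modules.pullback Gr).obj D.P) 1 := X₀.hasRank_pullback_graph_P Gr
  -- `n := 2N ∈ (A⧸J₀)^×`
  haveI : NeZero (2 * N) := ⟨mul_ne_zero two_ne_zero (NeZero.ne N)⟩
  have h2n : IsUnit ((2 : ℕ) : A) := by exact_mod_cast h2
  have h2' : IsUnit ((2 : ℕ) : A ⧸ J₀) := by
    have h := h2n.map (Ideal.Quotient.mk J₀)
    rwa [map_natCast] at h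
  have hn : IsUnit ((2 * N : ℕ) : A ⧸ J₀) := by rw [Nat.cast_mul]; exact h2'.mul hN
  -- `K(L^Δ(λ))` is killed by `2N`
  have hkill : ∀ (T : Over (Spec (.of (A ⧸ J₀)))) (u : T ⟶ X₀.X), X₀.MemKOfL ((Scheme.Modules.pullback Gr).obj D.P) u →
      u ^ (2 * N) = 1 := by
    intro T u hu
    have hmem := ((pol.sq_comp_lam_classify_mumfordBundle_LDelta X₀ D Gr hGr₁ hGr₂ hD).2 u).mp hu
    have hu2 : (u ^ 2) ≫ pol.lam = 1 := by
      rw [← Category.assoc, MonObj.comp_pow, Category.comp_id] at hmem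
      exact hmem
    have hk := pol.pow_eq_one_of_comp_lam_eq_one_of_finrank_lam_eq X₀ hdeg hN (u ^ 2) hu2
    rw [← pow_mul] at hk
    exact hk
  exact exists_abelianLift_of_isUnit_two_of_letter J₀ hJ₀ h2 X₀ hg hP _ hL
    (pol.cechPic_pullback_unitSection_detClass_LDelta_eq_one X₀ Gr hGr₁ hGr₂ (HasRank.isFiniteLocallyFree' hL))
    (fun Ω _ _ s => pol.exists_isAmple_pullback_fst_detClass_LDelta_eq_cechClass X₀ Gr hGr₁ hGr₂ (HasRank.isFiniteLocallyFree' hL) s)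
    (2 * N) hn hkill

open scoped MonObj in
/-- **(O9e′) = (U) for polarised abelian schemes, BOOKED CURRENCY**: the same with the degree hypothesis as ★ `Polarization.HasDegree d`
([MumfordFogartyKirwan1994] Def. 7.2 (ii): `λ_* 𝒪_{X₀}` locally free of rank `d²`; `λ` finite, flatness follows, ★ (O9f) `flat_lam_left_of_hasDegree`) and
`2d ∈ A^×` (★ (O9f) `finrank_lam_left_eq_of_hasDegree`).
[cite: Oort1971, Theorem (2.2.1) (p. 273) and pp. 277–280] [cite: MumfordFogartyKirwan1994, Ch. 7 §2 Definition 7.2 (p. 129); Ch. 6 §2 Proposition 6.10 (p. 121)]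
[cite: MumfordAV1970, §13 (p. 123), §13 Cor. 2 (p. 129), §23 (p. 231)] [cite: GortzWedhorn2023, Prop. 27.86 (p. 633)] -/
theorem exists_abelianLift_of_polarization_hasDegree_of_isUnit_two_mul (J₀ : Ideal A) (hJ₀ : J₀ ≠ ⊤) {g : ℕ}
    (X₀ : AbelianSchemeOver (Spec (.of (A ⧸ J₀)))) (hg : X₀.IsOfRelDim g) (hP : Morphisms.IsProjective X₀.X.hom)
    (D : X₀.DualPair) (hD : Nonempty ((Scheme.Modules.pullback (DualPair.unitHatSlice D)).obj D.P ≅ SheafOfModules.unit _))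
    (pol : X₀.Polarization D) [IsFinite pol.lam.left] {d : ℕ} (hdeg : pol.HasDegree d) (h2d : IsUnit ((2 * d : ℕ) : A)) :
    ∃ (X : AbelianSchemeOver (Spec (.of A))) (_ : X.IsOfRelDim g) (G : X₀.X.left ⟶ X.X.left),
      X₀.IsBaseChangeVia X (Spec.map (CommRingCat.ofHom (Ideal.Quotient.mk J₀))) G := by
  rw [Nat.cast_mul] at h2d
  have h2 : IsUnit ((2 : ℕ) : A) := (IsUnit.mul_iff.mp h2d).1
  have hd : IsUnit ((d : ℕ) : A) := (IsUnit.mul_iff.mp h2d).2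
  have hd0 : d ≠ 0 := by
    rintro rfl
    rw [Nat.cast_zero, isUnit_zero_iff] at hd
    exact zero_ne_one hd
  haveI : NeZero (d ^ 2) := ⟨pow_ne_zero 2 hd0⟩
  have hd' : IsUnit ((d : ℕ) : A ⧸ J₀) := by
    have h := hd.map (Ideal.Quotient.mk J₀)
    rwa [map_natCast] at h
  have hN : IsUnit ((d ^ 2 : ℕ) : A ⧸ J₀) := by rw [Nat.cast_pow]; exact hd'.pow 2
  haveI : Flat pol.lam.left := pol.flat_lam_left_of_hasDegree hdeg
  exact exists_abelianLift_of_isUnit_two_of_polarization_finrank_eq J₀ hJ₀ (by exact_mod_cast h2) X₀ hg hP D hD pol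
    (pol.finrank_lam_left_eq_of_hasDegree hdeg) hN

end Literature.AlgebraicGeometry.AbelianSchemes.AbelianSchemeOver

end
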